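import Summits.Ventures.LatticeQCDFlow.Scaling.FlowLadderConjugacy
import Summits.Ventures.LatticeQCDFlow.Scaling.ReplicaExchangeModeGap

/-!
HONEST FRAMING: exact (Metropolis-corrected) sampling algorithms for lattice gauge theory; figures
of merit are autocorrelation/cost numbers at stated couplings and volumes; no continuum-physics
claim.

# FlowLadderModeGap — SECTOR-PRESERVING ADJACENT MAPS: THE REPLICA-EXCHANGE MODE-GAP FLOOR OF
# `Scaling/ReplicaExchangeModeGap` HOLDS FOR THE FLOW LADDER WITH THE SECTOR-WISE ACCEPTANCE MASS OF THE MAP-ASSISTED SWAP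
# IN PLACE OF THE SECTOR-WISE OVERLAP: `Gap(ptFlowSampler ½ μ M φ) ≥ p q^K γ_A·min{δ₂^φ/K², γ₀/(K+1)}/(96(K+1)²)`
# (lean-2 GEN-21, ours)

Venture-side (OURS).  Cell `lqcd-flow` (pub-lqcd), unit `pub-lqcd-lean-2-g21`, 2026-08-26.  Chapter I, sixth file.  The
flows of this venture cannot tunnel between topological sectors (`Scaling/SimulatedTemperingFlowTorpid`,
`Scaling/ReplicaExchangeFlowSwapDiffusive`: sector-preserving maps), but they can transport each sector's conditional
law at one coupling onto the next.  This file says what that buys in replica exchange: the JSTV mode-gap floor of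
`Scaling/ReplicaExchangeModeGap` (R3′: `Gap(ptBareSampler ½ μ M) ≥ p q^K γ_A·min{δ₂/K², γ₀/(K+1)}/(96(K+1)²)` from
persistence `p`, cooling `q`, within-sector relaxation `γ_A`, the HOT replica's global relaxation `γ₀` and the
SECTOR-WISE swap overlap `δ₂`) holds for the flow ladder `ptFlowSampler ½ μ M φ` with SECTOR-PRESERVING maps
(`mode(φ_j u) = mode(u)`), with `δ₂` replaced by the sector-wise acceptance mass of the MAP-ASSISTED swap
(`δ₂·min{π̃(B_m), π̃(B_{m∘σ_l})} ≤ Σ_{x ∈ B_m} min{π̃(x), π̃(flowSwapAt φ l x)}`) and every other constant UNCHANGED.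
Mechanism: the level coordinates of `Scaling/FlowLadderConjugacy` preserve the sector partition when the maps do, and
block masses, block laws, restriction chains and Poincaré constants are invariant under a sector-preserving relabelling
(§1).

## What is proved

* §1 (generic, sector-preserving relabelling `e`, `blk∘e = blk`) `lawMean_relabel`, `lawVariance_relabel`,
  `dirichletForm_relabel`, **`poincare_relabel`** (Poincaré inequalities transfer), `blockMass_relabel`,
  `blockLaw_relabel`, **`restrictionChain_relabel`**, `blockPoincare_relabel`.
* §2 `ladderRelabel_mode` (the composed level maps preserve sectors), `blockMass_tensorFun_relabel`,
  `modeOverlap_relabel` (the sector-wise plain-swap overlap of the pulled-back laws IS the sector-wise acceptance mass of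
  the map-assisted swap), **`flowLadderMode_spectralGap_ge_levelMaps`**, and the `φ`-form
  **`flowLadderMode_spectralGap_ge`**: sector-preserving adjacent maps, `K ≥ 1`, `|S| ≥ 2` ⇒
  `Gap(ptFlowSampler ½ μ M φ) ≥ p q^K γ_A·min{δ₂/K², γ₀/(K+1)}/(96(K+1)²)`.

Reading (no numerics implied): a sector-preserving flow trained between neighbouring couplings raises the sector-wise
swap acceptance `δ₂` towards one and leaves the tunnelling to the hot replica (`γ₀`) and the cooling/persistence of
the sector WEIGHTS (`p`, `q^K`) — which no sector-preserving map can change.  NOT CLAIMED: maps that move mass between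
sectors; the `q`-free rotation form (`Scaling/ReplicaExchangeModeGapHeating` would transfer the same way); anything
measured.  Literature grade (cell rule): OWN MECHANISM, NEW TYPING; nothing cited as a fact; no new bib keys.
-/

noncomputable section

open Finset Function
open Literature.Probability.MarkovChains
open Literature.Probability.MarkovChains.Decomposition

namespace Summit.Ventures.LatticeQCDFlow.Scaling

/-! ## §1 Sector-preserving relabelling of one level -/

section Relabel

variable {X I : Type*} [Fintype X] [DecidableEq X] [DecidableEq I]

omit [DecidableEq X] in
/-- `E_{π∘e}(h) = E_π(h∘e⁻¹)`. [ours] -/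
theorem lawMean_relabel (e : X ≃ X) (π h : X → ℝ) :
    lawMean (fun x => π (e x)) h = lawMean π (fun y => h (e.symm y)) := by
  unfold lawMean
  rw [← e.sum_comp (fun y => π y * h (e.symm y))]
  simp only [Equiv.symm_apply_apply]

omit [DecidableEq X] in
/-- `Var_{π∘e}(h) = Var_π(h∘e⁻¹)`. [ours] -/
theorem lawVariance_relabel (e : X ≃ X) (π h : X → ℝ) :
    lawVariance (fun x => π (e x)) h = lawVariance π (fun y => h (e.symm y)) := by
  unfold lawVariance
  rw [lawMean_relabel, ← e.sum_comp (fun y => π y * (h (e.symm y) - lawMean π (fun y => h (e.symm y))) ^ 2)]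
  simp only [Equiv.symm_apply_apply]

omit [DecidableEq X] in
/-- `𝓔_{π∘e, P∘e}(h) = 𝓔_{π,P}(h∘e⁻¹)`. [ours] -/
theorem dirichletForm_relabel (e : X ≃ X) (π : X → ℝ) (P : Matrix X X ℝ) (h : X → ℝ) :
    dirichletForm (fun x => π (e x)) (fun x y => P (e x) (e y)) h = dirichletForm π P (fun y => h (e.symm y)) := by
  unfold dirichletForm
  congr 1
  rw [← e.sum_comp (fun x' => ∑ y', π x' * P x' y' * (h (e.symm x') - h (e.symm y')) ^ 2)]
  refine sum_congr rfl fun x _ => ?_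
  rw [← e.sum_comp (fun y' => π (e x) * P (e x) y' * (h (e.symm (e x)) - h (e.symm y')) ^ 2)]
  simp only [Equiv.symm_apply_apply]

omit [DecidableEq X] in
/-- **Poincaré inequalities transfer under relabelling:** `γ·Var_π ≤ 𝓔_{π,P}` for all test functions implies the same
for `(π∘e, P∘e)`. [ours] -/
theorem poincare_relabel (e : X ≃ X) {π : X → ℝ} {P : Matrix X X ℝ} {γ : ℝ}
    (hgap : ∀ h : X → ℝ, γ * lawVariance π h ≤ dirichletForm π P h) (h : X → ℝ) :
    γ * lawVariance (fun x => π (e x)) h ≤ dirichletForm (fun x => π (e x)) (fun x y => P (e x) (e y)) h := by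
  rw [lawVariance_relabel, dirichletForm_relabel]; exact hgap _

variable {blk : X → I} (e : X ≃ X) (he : ∀ x, blk (e x) = blk x)
include he

omit [DecidableEq X] in
/-- A sector-preserving relabelling permutes each block: `Σ_{x ∈ Ω_i} g(e x) = Σ_{x ∈ Ω_i} g(x)`. [ours] -/
theorem sum_block_relabel (i : I) (g : X → ℝ) : ∑ x ∈ block blk i, g (e x) = ∑ x ∈ block blk i, g x := by
  classical
  unfold block
  rw [Finset.sum_filter, Finset.sum_filter, ← e.sum_comp (fun x => if blk x = i then g x else 0)]
  exact sum_congr rfl fun x _ => by rw [he]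

omit [DecidableEq X] in
/-- Block masses are invariant: `blockMass (π∘e) blk i = blockMass π blk i`. [ours] -/
theorem blockMass_relabel (π : X → ℝ) (i : I) : blockMass (fun x => π (e x)) blk i = blockMass π blk i := by
  unfold blockMass; exact sum_block_relabel e he i π

omit [DecidableEq X] in
/-- Block laws relabel pointwise: `blockLaw (π∘e) blk i x = blockLaw π blk i (e x)`. [ours] -/
theorem blockLaw_relabel (π : X → ℝ) (i : I) (x : X) :
    blockLaw (fun x => π (e x)) blk i x = blockLaw π blk i (e x) := by
  simp only [blockLaw, he, blockMass_relabel e he]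

/-- **Restriction chains relabel:** `restrictionChain (P∘e) blk x y = restrictionChain P blk (e x) (e y)`. [ours] -/
theorem restrictionChain_relabel (P : Matrix X X ℝ) (x y : X) :
    restrictionChain (fun x y => P (e x) (e y)) blk x y = restrictionChain P blk (e x) (e y) := by
  rw [restrictionChain_apply, restrictionChain_apply, he, he]
  by_cases hb : blk y = blk x
  · rw [if_pos hb, if_pos hb]
    by_cases hyx : y = x
    · rw [hyx, if_pos rfl, if_pos rfl]
      congr 1
      -- `Σ_{z ∈ Ω_{blk x} ∖ {x}} P(e x, e z) = Σ_{z' ∈ Ω_{blk (e x)} ∖ {e x}} P(e x, z')`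
      rw [Finset.sum_erase_eq_sub (mem_block.mpr rfl), Finset.sum_erase_eq_sub (mem_block.mpr (he x)),
        sum_block_relabel e he (blk x) (fun z => P (e x) z)]
    · rw [if_neg hyx, if_neg (fun h => hyx (e.injective h))]
  · rw [if_neg hb, if_neg hb]

/-- **Within-block Poincaré constants transfer:** `γ·Var_{π_i} ≤ 𝓔_{π_i, P_i}` for the relabelled level follows from the
original. [ours] -/
theorem blockPoincare_relabel {π : X → ℝ} {P : Matrix X X ℝ} {γ : ℝ} (i : I)
    (hgap : ∀ h : X → ℝ, γ * lawVariance (blockLaw π blk i) h ≤ dirichletForm (blockLaw π blk i) (restrictionChain P blk) h)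
    (h : X → ℝ) :
    γ * lawVariance (blockLaw (fun x => π (e x)) blk i) h
      ≤ dirichletForm (blockLaw (fun x => π (e x)) blk i) (restrictionChain (fun x y => P (e x) (e y)) blk) h := by
  have e1 : blockLaw (fun x => π (e x)) blk i = fun x => blockLaw π blk i (e x) := funext (blockLaw_relabel e he π i)
  have e2 : restrictionChain (fun x y => P (e x) (e y)) blk = fun x y => restrictionChain P blk (e x) (e y) :=
    funext fun x => funext fun y => restrictionChain_relabel e he P x y
  rw [e1, e2]
  exact poincare_relabel e hgap h

end Relabel

/-! ## §2 The flow ladder with sector-preserving maps -/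

section ModeGap

variable {S J : Type*} [Fintype S] [DecidableEq S] [Fintype J] [DecidableEq J] {K : ℕ}
  {μ : Fin (K + 1) → S → ℝ} {M : Fin (K + 1) → S → S → ℝ} {mode : S → J}

omit [Fintype S] [DecidableEq S] [Fintype J] [DecidableEq J] in
/-- Sector-preserving adjacent maps have sector-preserving level coordinates: if `L_0 = 1`, `φ_j = L_{j+1}⁻¹∘L_j` and
`mode∘φ_j = mode` for all `j`, then `mode∘L_i⁻¹ = mode` for every level. [ours] -/
theorem ladderRelabel_mode (L : Fin (K + 1) → Equiv.Perm S) (hL0 : L 0 = Equiv.refl S) (φ : Fin K → Equiv.Perm S)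
    (hLφ : ∀ j : Fin K, (L j.castSucc).trans (L j.succ).symm = φ j) (hφmode : ∀ (j : Fin K) (u : S), mode (φ j u) = mode u)
    (i : Fin (K + 1)) (u : S) : mode ((L i).symm u) = mode u := by
  induction i using Fin.induction generalizing u with
  | zero => rw [hL0]; rfl
  | succ j ih =>
    have h := Equiv.ext_iff.mp (hLφ j) ((L j.castSucc).symm u)
    simp only [Equiv.trans_apply, Equiv.apply_symm_apply] at h
    rw [h, hφmode, ih]

omit [DecidableEq S] [Fintype J] [DecidableEq J] in
/-- Block masses of the product law are invariant under sector-preserving level coordinates. [ours] -/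
theorem blockMass_tensorFun_relabel (L : Fin (K + 1) → Equiv.Perm S) (hLmode : ∀ (i : Fin (K + 1)) (u : S), mode (L i u) = mode u)
    [DecidableEq J] (m : Fin (K + 1) → J) :
    blockMass (tensorFun (fun i u => μ i ((L i).symm u))) (fun z : Fin (K + 1) → S => mode ∘ z) m
      = blockMass (tensorFun μ) (fun z : Fin (K + 1) → S => mode ∘ z) m := by
  have hΨ : ∀ z : Fin (K + 1) → S,
      (fun z : Fin (K + 1) → S => mode ∘ z) (Equiv.piCongrRight L z) = (fun z : Fin (K + 1) → S => mode ∘ z) z :=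
    fun z => by funext i; simp [hLmode]
  have h := blockMass_relabel (Equiv.piCongrRight L) hΨ (tensorFun (fun i u => μ i ((L i).symm u))) m
  rw [← h]
  congr 1
  funext x
  exact (tensorFun_relabel L μ x).symm

omit [DecidableEq S] [Fintype J] [DecidableEq J] in
/-- **The sector-wise overlap of the pulled-back laws is the sector-wise acceptance mass of the map-assisted swap:**
`Σ_{x ∈ B_m} min{ν̃(x), ν̃(x∘σ_l)} = Σ_{y ∈ B_m} min{π̃(y), π̃(flowSwapAt φ^L l y)}`. [ours] -/
theorem modeOverlap_relabel (L : Fin (K + 1) → Equiv.Perm S) (hLmode : ∀ (i : Fin (K + 1)) (u : S), mode (L i u) = mode u)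
    [DecidableEq J] (m : Fin (K + 1) → J) (l : Fin K) :
    ∑ x ∈ block (fun z : Fin (K + 1) → S => mode ∘ z) m,
        min (tensorFun (fun i u => μ i ((L i).symm u)) x) (tensorFun (fun i u => μ i ((L i).symm u)) (x ∘ levelSwap l))
      = ∑ y ∈ block (fun z : Fin (K + 1) → S => mode ∘ z) m,
          min (tensorFun μ y) (tensorFun μ (flowSwapAt (fun j : Fin K => (L j.castSucc).trans (L j.succ).symm) l y)) := by
  have hΨ : ∀ z : Fin (K + 1) → S,
      (fun z : Fin (K + 1) → S => mode ∘ z) (Equiv.piCongrRight L z) = (fun z : Fin (K + 1) → S => mode ∘ z) z :=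
    fun z => by funext i; simp [hLmode]
  rw [← sum_block_relabel (Equiv.piCongrRight L) hΨ m (fun x => min (tensorFun (fun i u => μ i ((L i).symm u)) x)
    (tensorFun (fun i u => μ i ((L i).symm u)) (x ∘ levelSwap l)))]
  refine sum_congr rfl fun y _ => ?_
  have e1 : tensorFun (fun i u => μ i ((L i).symm u)) (Equiv.piCongrRight L y) = tensorFun μ y :=
    (tensorFun_relabel L μ y).symm
  have e2 : tensorFun (fun i u => μ i ((L i).symm u)) ((Equiv.piCongrRight L y) ∘ levelSwap l)
      = tensorFun μ (flowSwapAt (fun j : Fin K => (L j.castSucc).trans (L j.succ).symm) l y) := by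
    rw [show (Equiv.piCongrRight L y) ∘ levelSwap l
        = fun i => L i (flowSwapAt (fun j : Fin K => (L j.castSucc).trans (L j.succ).symm) l y i)
        from (ladderRelabel_flowSwapAt L y l).symm, ← tensorFun_relabel L μ]
  simp only [e1, e2]

/-- **THE MODE-GAP FLOOR IN LEVEL COORDINATES:** sector-preserving level maps (`mode∘L_i = mode`, `L_0 = 1`); persistence
`p` and cooling `q` of the sector WEIGHTS, within-sector Poincaré constant `γ_A` of every replica update, a global
Poincaré constant `γ₀` of the hot update, and the sector-wise acceptance mass `δ₂` of the MAP-ASSISTED swap: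
`Gap(ptFlowSampler ½ μ M φ^L) ≥ p q^K γ_A·min{δ₂/K², γ₀/(K+1)}/(96(K+1)²)`. [ours] -/
theorem flowLadderMode_spectralGap_ge_levelMaps [Nontrivial S] (L : Fin (K + 1) → Equiv.Perm S)
    (hL0 : L 0 = Equiv.refl S) (hLmode : ∀ (i : Fin (K + 1)) (u : S), mode (L i u) = mode u)
    (hμ : ∀ k x, 0 < μ k x) (hμ1 : ∀ k, ∑ x, μ k x = 1) (hmode : Function.Surjective mode) (hK : 1 ≤ K)
    (hM : ∀ k, IsRowStochastic (M k)) (hMrev : ∀ k, DetailedBalance (μ k) (M k))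
    {p q δ₂ γ₀ γA : ℝ} (hp : 0 < p) (hp1 : p ≤ 1) (hq0 : 0 < q) (hq1 : q ≤ 1) (hδ0 : 0 < δ₂) (hδ1 : δ₂ ≤ 1)
    (hγ₀ : 0 < γ₀) (hγA : 0 < γA) (hγA1 : γA ≤ 1)
    (hpers : ∀ (i k : Fin (K + 1)) (j : J), i ≤ k → p * blockMass (μ k) mode j ≤ blockMass (μ i) mode j)
    (hq : ∀ (l : Fin K) (j : J), q * blockMass (μ l.castSucc) mode j ≤ blockMass (μ l.succ) mode j)
    (hδ : ∀ (m : Fin (K + 1) → J) (l : Fin K), m ∘ levelSwap l ≠ m →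
      δ₂ * min (blockMass (tensorFun μ) (fun z : Fin (K + 1) → S => mode ∘ z) m)
          (blockMass (tensorFun μ) (fun z : Fin (K + 1) → S => mode ∘ z) (m ∘ levelSwap l))
        ≤ ∑ y ∈ block (fun z : Fin (K + 1) → S => mode ∘ z) m,
            min (tensorFun μ y) (tensorFun μ (flowSwapAt (fun j : Fin K => (L j.castSucc).trans (L j.succ).symm) l y)))
    (hgap0 : ∀ h : S → ℝ, γ₀ * lawVariance (μ 0) h ≤ dirichletForm (μ 0) (M 0) h)
    (hgapA : ∀ k j, ∀ h : S → ℝ, γA * lawVariance (blockLaw (μ k) mode j) h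
      ≤ dirichletForm (blockLaw (μ k) mode j) (restrictionChain (M k) mode) h) :
    p * q ^ K * γA * min (δ₂ / K ^ 2) (γ₀ / (K + 1)) / (96 * (K + 1) ^ 2)
      ≤ spectralGap (tensorFun μ) (ptFlowSampler (1 / 2) μ M (fun j : Fin K => (L j.castSucc).trans (L j.succ).symm)) := by
  rw [ptFlowSampler_spectralGap_eq_conj L (1 / 2) μ M]
  have hLmode' : ∀ (i : Fin (K + 1)) (u : S), mode ((L i).symm u) = mode u := fun i u => by
    have h := hLmode i ((L i).symm u); rw [Equiv.apply_symm_apply] at h; exact h.symm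
  have hL0u : ∀ u, (L 0).symm u = u := fun u => by rw [hL0]; rfl
  have hν0 : (fun u => μ 0 ((L 0).symm u)) = μ 0 := funext fun u => by rw [hL0u]
  have hM0 : (fun u v => M 0 ((L 0).symm u) ((L 0).symm v)) = M 0 := funext fun u => funext fun v => by rw [hL0u, hL0u]
  -- block masses of the pulled-back levels are those of `μ`
  have hbm : ∀ (k : Fin (K + 1)) (j : J), blockMass (fun u => μ k ((L k).symm u)) mode j = blockMass (μ k) mode j :=
    fun k j => blockMass_relabel (L k).symm (hLmode' k) (μ k) j
  refine ptBareModeHalf_spectralGap_ge_of_hotGap (μ := fun i u => μ i ((L i).symm u))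
    (M := fun i u v => M i ((L i).symm u) ((L i).symm v)) (mode := mode) (fun k u => hμ k _)
    (fun k => by rw [Equiv.sum_comp (L k).symm (μ k)]; exact hμ1 k) hmode hK
    (fun k => ⟨fun u v => (hM k).1 _ _, fun u => ?_⟩) (fun k u v => hMrev k _ _) hp hp1 hq0 hq1 hδ0 hδ1 hγ₀ hγA hγA1
    (fun i k j hik => by rw [hbm, hbm]; exact hpers i k j hik) (fun l j => by rw [hbm, hbm]; exact hq l j)
    (fun m l hml => ?_) ?_ (fun k j h => ?_)
  · simpa using (Equiv.sum_comp (L k).symm (fun v => M k ((L k).symm u) v)).trans ((hM k).2 _)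
  · rw [blockMass_tensorFun_relabel L hLmode, blockMass_tensorFun_relabel L hLmode, modeOverlap_relabel L hLmode]
    exact hδ m l hml
  · intro h
    have e1 : lawVariance (fun u => μ 0 ((L 0).symm u)) h = lawVariance (μ 0) h := by rw [hν0]
    have e2 : dirichletForm (fun u => μ 0 ((L 0).symm u)) (fun u v => M 0 ((L 0).symm u) ((L 0).symm v)) h
        = dirichletForm (μ 0) (M 0) h := by rw [hν0, hM0]
    rw [e1, e2]; exact hgap0 h
  · exact blockPoincare_relabel (L k).symm (hLmode' k) j (hgapA k j) h

/-- **THE MODE-GAP FLOOR FOR THE FLOW LADDER WITH SECTOR-PRESERVING MAPS:** for adjacent bijections `φ_j` with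
`mode(φ_j u) = mode(u)` (`K ≥ 1`, `|S| ≥ 2`), persistence `p`/cooling `q` of the sector weights, within-sector Poincaré
constant `γ_A`, hot global Poincaré constant `γ₀`, and the sector-wise acceptance mass `δ₂` of the map-assisted swaps
(`δ₂·min{π̃(B_m), π̃(B_{m∘σ_l})} ≤ Σ_{y ∈ B_m} min{π̃(y), π̃(flowSwapAt φ l y)}`):
`Gap(ptFlowSampler ½ μ M φ) ≥ p q^K γ_A·min{δ₂/K², γ₀/(K+1)}/(96(K+1)²)`. [ours] -/
theorem flowLadderMode_spectralGap_ge [Nontrivial S] (φ : Fin K → Equiv.Perm S)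
    (hφmode : ∀ (j : Fin K) (u : S), mode (φ j u) = mode u)
    (hμ : ∀ k x, 0 < μ k x) (hμ1 : ∀ k, ∑ x, μ k x = 1) (hmode : Function.Surjective mode) (hK : 1 ≤ K)
    (hM : ∀ k, IsRowStochastic (M k)) (hMrev : ∀ k, DetailedBalance (μ k) (M k))
    {p q δ₂ γ₀ γA : ℝ} (hp : 0 < p) (hp1 : p ≤ 1) (hq0 : 0 < q) (hq1 : q ≤ 1) (hδ0 : 0 < δ₂) (hδ1 : δ₂ ≤ 1)
    (hγ₀ : 0 < γ₀) (hγA : 0 < γA) (hγA1 : γA ≤ 1)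
    (hpers : ∀ (i k : Fin (K + 1)) (j : J), i ≤ k → p * blockMass (μ k) mode j ≤ blockMass (μ i) mode j)
    (hq : ∀ (l : Fin K) (j : J), q * blockMass (μ l.castSucc) mode j ≤ blockMass (μ l.succ) mode j)
    (hδ : ∀ (m : Fin (K + 1) → J) (l : Fin K), m ∘ levelSwap l ≠ m →
      δ₂ * min (blockMass (tensorFun μ) (fun z : Fin (K + 1) → S => mode ∘ z) m)
          (blockMass (tensorFun μ) (fun z : Fin (K + 1) → S => mode ∘ z) (m ∘ levelSwap l))
        ≤ ∑ y ∈ block (fun z : Fin (K + 1) → S => mode ∘ z) m, min (tensorFun μ y) (tensorFun μ (flowSwapAt φ l y)))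
    (hgap0 : ∀ h : S → ℝ, γ₀ * lawVariance (μ 0) h ≤ dirichletForm (μ 0) (M 0) h)
    (hgapA : ∀ k j, ∀ h : S → ℝ, γA * lawVariance (blockLaw (μ k) mode j) h
      ≤ dirichletForm (blockLaw (μ k) mode j) (restrictionChain (M k) mode) h) :
    p * q ^ K * γA * min (δ₂ / K ^ 2) (γ₀ / (K + 1)) / (96 * (K + 1) ^ 2)
      ≤ spectralGap (tensorFun μ) (ptFlowSampler (1 / 2) μ M φ) := by
  obtain ⟨L, hL0, hLφ⟩ := exists_levelMaps φ
  have hφ : φ = fun j : Fin K => (L j.castSucc).trans (L j.succ).symm := (funext hLφ).symm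
  have hLmode' := ladderRelabel_mode (mode := mode) L hL0 φ hLφ hφmode
  have hLmode : ∀ (i : Fin (K + 1)) (u : S), mode (L i u) = mode u := fun i u => by
    have h := hLmode' i (L i u); rw [Equiv.symm_apply_apply] at h; exact h.symm
  subst hφ
  exact flowLadderMode_spectralGap_ge_levelMaps L hL0 hLmode hμ hμ1 hmode hK hM hMrev hp hp1 hq0 hq1 hδ0 hδ1 hγ₀ hγA
    hγA1 hpers hq hδ hgap0 hgapA

end ModeGap

end Summit.Ventures.LatticeQCDFlow.Scaling

end
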